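import Summits.HodgeConjecture.HodgeConjecture.Theorems.NikulinTwinTransportSquareKunneth
import Summits.HodgeConjecture.HodgeConjecture.Theorems.NikulinTwinTransportSquareHodgeTypes
import Summits.HodgeConjecture.HodgeConjecture.Theorems.NikulinTwinTransportSquareRationality
import Summits.HodgeConjecture.HodgeConjecture.Theorems.NikulinTwinTransportSquareTranscendental
import Summits.HodgeConjecture.HodgeConjecture.Theorems.NikulinTwinTransportRealMultiplicationDivisorCorrespondences
import Literature.AlgebraicGeometry.HodgeTheory.TopDegreeClasses

/-!
# Route NikulinTwinTransport · item `SquareHodgeOfSqrtTwo` (stmt-HodgeConjecture-13680) —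
# the rational `(2,2)`-classes of `S ⊗ S` are algebraic when `End_Hdg(T(S)) = ℚ + ℚ e` with `e`
# algebraic

Sixth file of the Künneth bookkeeping for the square of a projective K3 surface `S` (Varesco 2023,
p. 8: "proving the Hodge conjecture for `X²` is equivalent to showing that every element of
`End_Hdg(T(X))` is algebraic"; Voisin I, Lemma 11.41). THE HEART: for a rational `(2,2)`-class
`c = Σᵢ fst^* vᵢ ∪ snd^* uᵢ + t₄ • snd^* p + t₀ • fst^* p` on `S ⊗ S` ((vᵢ) the marked basis of
`H²(S(ℂ); ℂ)`), the endomorphism `f : x ↦ Σᵢ (x.uᵢ) vᵢ` is a rational Hodge endomorphism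
(`…SquareHodgeTypes`, `…SquareRationality`); it preserves `N = NS(S)_ℂ` (Lefschetz `(1,1)`) and
`T = N^⊥` (through its transpose), so with the projection `π` onto `N` along `T`
(`…SquareTranscendental`) the hypothesis `End_Hdg(T)_ℚ = ℚ + ℚ·e` applied to `f ∘ (1 - π)` gives
`f = (f∘π - a π) + a·1 + b·e`; the three summands are the actions of algebraic classes — products
of divisors (`exists_rankOne_of_range_le`), the diagonal `Δ_* 1` (`exists_diagonal_correspondence`),
and the class `γ` of `e` (the antecedent `RealMultiplicationSqrtTwoAlgebraic`) — and a middle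
Künneth component is determined by its action (`(vᵢ)` a basis, the cup form non-degenerate), so
`c` is algebraic (`mem_algebraicClasses_of_typeTwoTwo`).

## References

* [Varesco2023] M. Varesco, Hodge similitudes and the Hodge conjecture for squares of K3 surfaces
  (2023), §2 (p. 8).
* [VoisinHodgeI2002] C. Voisin, Hodge Theory and Complex Algebraic Geometry I, CUP 2002, §11.3.3
  Lemma 11.41.
* [Fulton1998] W. Fulton, Intersection Theory, 2nd ed., Springer 1998, §16.1 (Cor. 16.1.2: the
  diagonal acts as the identity).
* [Huybrechts2016K3] D. Huybrechts, Lectures on K3 Surfaces, CUP 2016, Ch. 3 Lemma 3.3.1, Ch. 16.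
-/

noncomputable section

open CategoryTheory AlgebraicGeometry MonoidalCategory CartesianMonoidalCategory
open Literature.AlgebraicGeometry.Motives Literature.AlgebraicGeometry.HodgeTheory
open Literature.AlgebraicGeometry.Surfaces
open Literature.AlgebraicTopology.SingularHomology

namespace Summit.HodgeConjecture.HodgeConjecture.Theorems.NikulinTwinTransport

variable {S : SchemeOver ℂ}

/-! ### The diagonal correspondence acts as the identity -/

/-- **The class `δ = Δ_* 1` of the diagonal is algebraic and acts as the identity**:
`fst_*(snd^* x ∪ Δ_* 1) = fst_*(Δ_*(Δ^* snd^* x ∪ 1)) = (Δ ≫ fst)_*((Δ ≫ snd)^* x) = x` (projection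
formula and functoriality of the Gysin morphisms; `Δ_* 1 ∈ N² H⁴` by the proper push-forward of the
algebraic class `1`). [cite: Fulton1998, §16.1 Cor. 16.1.2] [cite: FultonYoungTableaux1997, Appendix B §B.1 (2), (5), (6)] -/
theorem exists_diagonal_correspondence (μ : OrientationFamily) (hS : IsSmoothProjective 2 S) :
    ∃ δ ∈ algebraicClasses (S ⊗ S) 2, ∀ x : complexBetti S (2 * 1),
      complexGysin μ (IsSmoothProjective.tensor_holds hS hS) hS (fst S S)
          (rfl : 2 * 1 + 2 * 2 + 2 * 2 = 2 * 1 + 2 * (2 + 2))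
          (cupProduct (rfl : 2 * 1 + 2 * 2 = 2 * 1 + 2 * 2) (complexBetti.map (snd S S) (2 * 1) x) δ) = x := by
  have hμ : μ.HasPoincareDuality := OrientationFamily.hasPoincareDuality μ
  have hP := IsSmoothProjective.tensor_holds hS hS
  let Δ : S ⟶ S ⊗ S := CartesianMonoidalCategory.lift (𝟙 S) (𝟙 S)
  refine ⟨complexGysin μ hS hP Δ (show 2 * 0 + 2 * (2 + 2) = 2 * 2 + 2 * 2 by norm_num)
    (singularCohomology.one ℂ (ComplexPoints S)), ?_, fun x ↦ ?_⟩
  · exact complexGysin_mem_algebraicClasses (gysinMap_restrictCompl_eq_zero_of_field ℂ) μ hμ hS hP Δ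
      (show 0 + (2 + 2) = 2 + 2 by norm_num) _ (by rw [algebraicClasses_zero]; exact Submodule.mem_top)
  · -- projection formula for `Δ`: `snd^* x ∪ Δ_* 1 = Δ_*(Δ^* snd^* x ∪ 1) = Δ_* x`
    have hpf := complexGysin_cup hμ hS hP Δ (show 2 * 1 + 2 * 0 = 2 * 1 by norm_num)
      (show 2 * 1 + 2 * (2 + 2) = (2 * 1 + 2 * 2) + 2 * 2 by norm_num)
      (show 2 * 0 + 2 * (2 + 2) = 2 * 2 + 2 * 2 by norm_num) (rfl : 2 * 1 + 2 * 2 = 2 * 1 + 2 * 2)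
      (complexBetti.map (snd S S) (2 * 1) x) (singularCohomology.one ℂ (ComplexPoints S))
    have hΔsnd : complexBetti.map Δ (2 * 1) (complexBetti.map (snd S S) (2 * 1) x) = x := by
      rw [← CategoryTheory.comp_apply, ← complexBetti.map_comp, CartesianMonoidalCategory.lift_snd,
        complexBetti.map_id, CategoryTheory.id_apply]
    rw [hΔsnd, cupProduct_one] at hpf
    rw [← hpf, ← LinearMap.comp_apply, ← complexGysin_comp hμ hS hP hS Δ (fst S S)
      (show 2 * 1 + 2 * (2 + 2) = (2 * 1 + 2 * 2) + 2 * 2 by norm_num)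
      (rfl : 2 * 1 + 2 * 2 + 2 * 2 = 2 * 1 + 2 * (2 + 2))]
    have hΔfst : Δ ≫ fst S S = 𝟙 S := CartesianMonoidalCategory.lift_fst _ _
    simp only [hΔfst, complexGysin_id hμ hS, LinearMap.id_apply]

/-- Rational classes are closed under subtraction (`c - c' = c + (-1) • c'`). [cite: HatcherAT2002, §3.1] -/
theorem isRationalClass_sub {Y : Type} [TopologicalSpace Y] {k : ℕ} {c c' : singularCohomology ℂ ℂ Y k}
    (hc : IsRationalClass c) (hc' : IsRationalClass c') : IsRationalClass (c - c') := by
  have h := hc.add (hc'.smul (-1))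
  rwa [Rat.cast_neg, Rat.cast_one, neg_one_smul, ← sub_eq_add_neg] at h

/-! ### Middle Künneth components are determined by their action -/

section Marked

variable (η : complexBetti S (2 * 1) ≃ₗ[ℂ] (K3Index → ℂ))

/-- The marked basis `η⁻¹ eₖ` of `H²(S(ℂ); ℂ)` and its coordinates `(η y)ₖ`: `Σₖ (η y)ₖ • η⁻¹ eₖ = y`.
[folklore] -/
theorem sum_coord_smul_basis (y : complexBetti S (2 * 1)) :
    ∑ k, η y k • η.symm (Pi.single k 1) = y := by
  have h := ((Pi.basisFun ℂ K3Index).map η.symm).sum_repr y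
  simpa only [Module.Basis.map_repr, LinearEquiv.trans_apply, LinearEquiv.symm_symm, Pi.basisFun_repr,
    Module.Basis.map_apply, Pi.basisFun_apply] using h

/-- **A middle Künneth datum is determined by its action**: if `Σₖ (ηx.η wₖ) • η⁻¹ eₖ = 0` for all `x`
then `w = 0` (the `η⁻¹ eₖ` are linearly independent and the K3 form is non-degenerate). [folklore] -/
theorem eq_zero_of_act_eq_zero (w : K3Index → complexBetti S (2 * 1))
    (h : ∀ x, ∑ k, k3Form (η x) (η (w k)) • η.symm (Pi.single k 1) = 0) : w = 0 := by
  funext k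
  have hind := ((Pi.basisFun ℂ K3Index).map η.symm).linearIndependent
  rw [Fintype.linearIndependent_iff] at hind
  have hk : ∀ x, k3Form (η x) (η (w k)) = 0 := fun x ↦ by
    refine hind (fun k ↦ k3Form (η x) (η (w k))) ?_ k
    simpa only [Module.Basis.map_apply, Pi.basisFun_apply] using h x
  rw [Pi.zero_apply]
  exact (nondegenerate_cupForm η).2 _ fun x ↦ by rw [cupForm_apply]; exact hk x

/-- The action `u ↦ (x ↦ Σₖ (ηx.η uₖ) • η⁻¹ eₖ)` is additive in the datum `u`. [folklore] -/
theorem act_sub (u u' : K3Index → complexBetti S (2 * 1)) (x : complexBetti S (2 * 1)) :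
    ∑ k, k3Form (η x) (η ((u - u') k)) • η.symm (Pi.single k 1) =
      (∑ k, k3Form (η x) (η (u k)) • η.symm (Pi.single k 1)) -
        ∑ k, k3Form (η x) (η (u' k)) • η.symm (Pi.single k 1) := by
  simp only [Pi.sub_apply, map_sub, ← k3FormC_apply, sub_smul, Finset.sum_sub_distrib]

/-- The action `u ↦ (x ↦ Σₖ (ηx.η uₖ) • η⁻¹ eₖ)` is homogeneous in the datum `u`. [folklore] -/
theorem act_smul (t : ℂ) (u : K3Index → complexBetti S (2 * 1)) (x : complexBetti S (2 * 1)) :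
    ∑ k, k3Form (η x) (η ((t • u) k)) • η.symm (Pi.single k 1) =
      t • ∑ k, k3Form (η x) (η (u k)) • η.symm (Pi.single k 1) := by
  simp only [Pi.smul_apply, map_smul, k3Form_smul_right, mul_smul, Finset.smul_sum]

/-- The middle Künneth class `u ↦ Σₖ fst^* η⁻¹eₖ ∪ snd^* uₖ` is additive in the datum `u`. [folklore] -/
theorem mid_add (u u' : K3Index → complexBetti S (2 * 1)) :
    (∑ k, cupProduct (rfl : 2 * 1 + 2 * 1 = 2 * 2)
        (complexBetti.map (fst S S) (2 * 1) (η.symm (Pi.single k 1)))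
        (complexBetti.map (snd S S) (2 * 1) ((u + u') k))) =
      (∑ k, cupProduct (rfl : 2 * 1 + 2 * 1 = 2 * 2)
        (complexBetti.map (fst S S) (2 * 1) (η.symm (Pi.single k 1)))
        (complexBetti.map (snd S S) (2 * 1) (u k))) +
      ∑ k, cupProduct (rfl : 2 * 1 + 2 * 1 = 2 * 2)
        (complexBetti.map (fst S S) (2 * 1) (η.symm (Pi.single k 1)))
        (complexBetti.map (snd S S) (2 * 1) (u' k)) := by
  simp only [Pi.add_apply, map_add, Finset.sum_add_distrib]

/-- The middle Künneth class `u ↦ Σₖ fst^* η⁻¹eₖ ∪ snd^* uₖ` is homogeneous in the datum `u`. [folklore] -/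
theorem mid_smul (t : ℂ) (u : K3Index → complexBetti S (2 * 1)) :
    (∑ k, cupProduct (rfl : 2 * 1 + 2 * 1 = 2 * 2)
        (complexBetti.map (fst S S) (2 * 1) (η.symm (Pi.single k 1)))
        (complexBetti.map (snd S S) (2 * 1) ((t • u) k))) =
      t • ∑ k, cupProduct (rfl : 2 * 1 + 2 * 1 = 2 * 2)
        (complexBetti.map (fst S S) (2 * 1) (η.symm (Pi.single k 1)))
        (complexBetti.map (snd S S) (2 * 1) (u k)) := by
  simp only [Pi.smul_apply, map_smul, Finset.smul_sum]

/-- A sum of cross products `Σᵢ fst^* bᵢ ∪ snd^* aᵢ` in middle Künneth form: expand the `bᵢ` in the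
marked basis. [folklore] -/
theorem sum_cross_eq_mid {m : ℕ} (av bw : Fin m → complexBetti S (2 * 1)) :
    (∑ i, cupProduct (rfl : 2 * 1 + 2 * 1 = 2 * 2) (complexBetti.map (fst S S) (2 * 1) (bw i))
        (complexBetti.map (snd S S) (2 * 1) (av i))) =
      ∑ k, cupProduct (rfl : 2 * 1 + 2 * 1 = 2 * 2)
        (complexBetti.map (fst S S) (2 * 1) (η.symm (Pi.single k 1)))
        (complexBetti.map (snd S S) (2 * 1) (∑ i, η (bw i) k • av i)) := by
  simp only [map_sum, map_smul]
  rw [Finset.sum_comm]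
  refine Finset.sum_congr rfl fun i _ ↦ ?_
  conv_lhs => rw [← sum_coord_smul_basis η (bw i)]
  simp only [map_sum, map_smul, LinearMap.sum_apply, LinearMap.smul_apply]

/-- The action of the middle Künneth datum of `Σᵢ fst^* bᵢ ∪ snd^* aᵢ` is `x ↦ Σᵢ (x.aᵢ) bᵢ`. [folklore] -/
theorem act_sum_cross {m : ℕ} (av bw : Fin m → complexBetti S (2 * 1)) (x : complexBetti S (2 * 1)) :
    ∑ k, k3Form (η x) (η (∑ i, η (bw i) k • av i)) • η.symm (Pi.single k 1) =
      ∑ i, k3Form (η x) (η (av i)) • bw i := by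
  have h : ∀ k, k3Form (η x) (η (∑ i, η (bw i) k • av i)) = ∑ i, η (bw i) k * k3Form (η x) (η (av i)) :=
    fun k ↦ by
      rw [map_sum, k3Form_comm]
      simp only [map_smul]
      rw [k3Form_sum_smul_left]
      exact Finset.sum_congr rfl fun i _ ↦ by rw [k3Form_comm]
  simp_rw [h, Finset.sum_smul, mul_smul]
  rw [Finset.sum_comm]
  refine Finset.sum_congr rfl fun i _ ↦ ?_
  simp_rw [smul_comm (η (bw i) _) (k3Form (η x) (η (av i)))]
  rw [← Finset.smul_sum, sum_coord_smul_basis η (bw i)]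

end Marked

/-! ### The heart: rational `(2,2)`-classes on `S ⊗ S` are algebraic -/

/-- **Rational `(2,2)`-classes on the square of a projective K3 surface `S` are algebraic, granted
`End_Hdg(T(S))_ℚ = ℚ + ℚ·e` with `e` induced by an algebraic class** (and the Künneth spanning
property, `b₁(S) = 0`, the Hodge index theorem and Lefschetz `(1,1)` for `S`, a marking of `S`, Hodge
models of `S` and `S ⊗ S` with the multiplicativity of Hodge types). See the module docstring for the
proof. [cite: Varesco2023, §2 (p. 8)] [cite: VoisinHodgeI2002, §11.3.3 Lemma 11.41]
[cite: Fulton1998, §16.1 Cor. 16.1.2] -/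
theorem mem_algebraicClasses_of_typeTwoTwo (μ : OrientationFamily) (hK3 : IsK3Surface S)
    (η : complexBetti S (2 * 1) ≃ₗ[ℂ] (K3Index → ℂ)) {p : complexBetti S (2 * 2)} (hp0 : p ≠ 0)
    (hpint : IsIntegralClass p)
    (hint : ∀ c : complexBetti S (2 * 1), IsIntegralClass c ↔ ∃ v : K3Index → ℤ, η c = fun i => (v i : ℂ))
    (hcup : ∀ a b : complexBetti S (2 * 1),
      cupProduct (rfl : 2 * 1 + 2 * 1 = 2 * 2) a b = k3Form (η a) (η b) • p)
    [Subsingleton (complexBetti S 1)]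
    (hKS : ∀ (k : ℕ) (z : complexBetti (S ⊗ S) k), z ∈ Submodule.span ℂ
      {v | ∃ (i j : ℕ) (h : i + j = k) (a : complexBetti S i) (w : complexBetti S j),
        v = cupProduct h (complexBetti.map (fst S S) i a) (complexBetti.map (snd S S) j w)})
    (A : HodgeModel 2 S) (M : HodgeModel 4 (S ⊗ S)) (hcupS : CupPreservesHodgeType 2 S)
    (hcupP : CupPreservesHodgeType 4 (S ⊗ S)) (hHI : hodgeIndex_surface S)
    (hN11 : ∀ d ∈ algebraicClasses S 1, IsOfHodgeType 2 S (2 * 1) 1 1 d)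
    (hL11 : ∀ c : complexBetti S (2 * 1), IsRationalClass c → IsOfHodgeType 2 S (2 * 1) 1 1 c →
      c ∈ algebraicClasses S 1)
    (e : complexBetti S (2 * 1) →ₗ[ℂ] complexBetti S (2 * 1))
    (he_N : ∀ d ∈ algebraicClasses S 1, e d = 0)
    (hEnd : ∀ (f : complexBetti S (2 * 1) →ₗ[ℂ] complexBetti S (2 * 1)),
      (∀ x, IsRationalClass x → IsRationalClass (f x)) →
      (∀ (i j : ℕ) x, IsOfHodgeType 2 S (2 * 1) i j x → IsOfHodgeType 2 S (2 * 1) i j (f x)) →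
      (∀ d ∈ algebraicClasses S 1, f d = 0) →
      (∀ x : complexBetti S (2 * 1), ∀ d ∈ algebraicClasses S 1,
        cupProduct (rfl : 2 * 1 + 2 * 1 = 2 * 2) (f x) d = 0) →
      ∃ a b : ℚ, ∀ x : complexBetti S (2 * 1),
        (∀ d ∈ algebraicClasses S 1, cupProduct (rfl : 2 * 1 + 2 * 1 = 2 * 2) x d = 0) →
        f x = (a : ℂ) • x + (b : ℂ) • e x)
    (hγ : ∃ γ ∈ algebraicClasses (S ⊗ S) 2, ∀ x : complexBetti S (2 * 1),
      e x = complexGysin μ (IsSmoothProjective.tensor_holds hK3.isSmoothProjective hK3.isSmoothProjective)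
        hK3.isSmoothProjective (fst S S) (rfl : 2 * 1 + 2 * 2 + 2 * 2 = 2 * 1 + 2 * (2 + 2))
        (cupProduct (rfl : 2 * 1 + 2 * 2 = 2 * 1 + 2 * 2) (complexBetti.map (snd S S) (2 * 1) x) γ))
    {c : complexBetti (S ⊗ S) (2 * 2)} (hc : IsRationalClass c)
    (hc22 : IsOfHodgeType 4 (S ⊗ S) (2 * 2) 2 2 c) : c ∈ algebraicClasses (S ⊗ S) 2 := by
  have hS := hK3.isSmoothProjective
  set N := algebraicClasses S 1 with hNdef
  have hBs : ∀ a b : complexBetti S (2 * 1), k3Form (η a) (η b) = k3Form (η b) (η a) :=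
    fun a b ↦ k3Form_comm _ _
  obtain ⟨c₀, hc₀, hFI⟩ := fibreIntegral_square_of_kunneth μ hS (hKS _) hp0
  have hpp := cross_top_ne_zero μ hS (hKS _) hp0
  have hbVb : ∀ k, ((Pi.basisFun ℂ K3Index).map η.symm) k = η.symm (Pi.single k 1) := fun k ↦ by
    rw [Module.Basis.map_apply, Pi.basisFun_apply]
  -- Künneth normal form of `c`
  obtain ⟨u, t₄, t₀, hcn⟩ := kunneth_four μ hS hKS hp0 ((Pi.basisFun ℂ K3Index).map η.symm) c
  simp only [hbVb] at hcn
  -- the endomorphism `f : x ↦ Σₖ (x.uₖ) vₖ` and its transpose `g`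
  obtain ⟨f, hf⟩ : ∃ f : complexBetti S (2 * 1) →ₗ[ℂ] complexBetti S (2 * 1),
      ∀ x, f x = ∑ k, k3Form (η x) (η (u k)) • η.symm (Pi.single k 1) :=
    ⟨∑ k, ((k3FormC.compl₁₂ η.toLinearMap η.toLinearMap : LinearMap.BilinForm ℂ _).flip (u k)).smulRight
      (η.symm (Pi.single k 1)), fun x ↦ by simp [LinearMap.sum_apply, LinearMap.smulRight_apply]⟩
  obtain ⟨g, hg⟩ : ∃ g : complexBetti S (2 * 1) →ₗ[ℂ] complexBetti S (2 * 1),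
      ∀ x, g x = ∑ k, k3Form (η x) (η (η.symm (Pi.single k 1))) • u k :=
    ⟨∑ k, ((k3FormC.compl₁₂ η.toLinearMap η.toLinearMap : LinearMap.BilinForm ℂ _).flip
      (η.symm (Pi.single k 1))).smulRight (u k),
      fun x ↦ by simp [LinearMap.sum_apply, LinearMap.smulRight_apply]⟩
  have hf_rat : ∀ x, IsRationalClass x → IsRationalClass (f x) := fun x hx ↦ by
    rw [hf]; exact isRationalClass_act_of_normalForm hK3 η hint hcup hpint hpp hc hcn hx
  have hg_rat : ∀ x, IsRationalClass x → IsRationalClass (g x) := fun x hx ↦ by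
    rw [hg]; exact isRationalClass_coact_of_normalForm hK3 η hint hcup hpint hpp hc hcn hx
  have hf_typ : ∀ (i j : ℕ) x, IsOfHodgeType 2 S (2 * 1) i j x → IsOfHodgeType 2 S (2 * 1) i j (f x) :=
    fun i j x hx ↦ by
      rw [hf]; exact isOfHodgeType_act_of_normalForm μ hS A M hcupS hcupP hcup hBs hpp hc22 hcn hx
  have hg_typ : ∀ (i j : ℕ) x, IsOfHodgeType 2 S (2 * 1) i j x → IsOfHodgeType 2 S (2 * 1) i j (g x) :=
    fun i j x hx ↦ by
      rw [hg]; exact isOfHodgeType_coact_of_normalForm μ hS A M hcupS hcupP hcup hBs hpp hc22 hcn hx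
  -- adjointness `(f x . y) = (x . g y)`
  have hadj : ∀ x y, k3Form (η (f x)) (η y) = k3Form (η x) (η (g y)) := by
    intro x y
    rw [hf, hg, map_sum, map_sum]
    simp only [map_smul]
    rw [k3Form_sum_smul_left, k3Form_comm (η x), k3Form_sum_smul_left]
    refine Finset.sum_congr rfl fun k _ ↦ ?_
    rw [k3Form_comm (η y) (η (η.symm (Pi.single k 1))), k3Form_comm (η (u k)) (η x)]
    ring
  -- `f`, `g` preserve `N` (Lefschetz (1,1)); hence `f` preserves `T`
  have hfN : ∀ d ∈ N, f d ∈ N := fun d hd ↦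
    map_mem_algebraicClasses_of_hodgeEndo hK3 hL11 hN11 f hf_rat (hf_typ 1 1) hd
  have hgN : ∀ d ∈ N, g d ∈ N := fun d hd ↦
    map_mem_algebraicClasses_of_hodgeEndo hK3 hL11 hN11 g hg_rat (hg_typ 1 1) hd
  have hfT : ∀ t, (∀ d ∈ N, cupProduct (rfl : 2 * 1 + 2 * 1 = 2 * 2) t d = 0) →
      ∀ d ∈ N, cupProduct (rfl : 2 * 1 + 2 * 1 = 2 * 2) (f t) d = 0 := by
    intro t ht d hd
    have h := ht (g d) (hgN d hd)
    rw [hcup, smul_eq_zero, or_iff_left hp0] at h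
    rw [hcup, hadj, h, zero_smul]
  -- the projection onto `N` along `T`
  obtain ⟨π, hπN, hπid, hπT, hπsub, hπrat, hπtyp⟩ :=
    exists_nsProjection hK3 η hp0 hint hcup hHI A hcupS hN11
  -- `End_Hdg(T) = ℚ + ℚ e` applied to `f ∘ (1 - π)`
  obtain ⟨a, b, hab⟩ := hEnd (f ∘ₗ (LinearMap.id - π))
    (fun x hx ↦ by
      rw [LinearMap.comp_apply, LinearMap.sub_apply, LinearMap.id_apply, map_sub]
      exact isRationalClass_sub (hf_rat x hx) (hf_rat _ (hπrat x hx)))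
    (fun i j x hx ↦ by
      rw [LinearMap.comp_apply, LinearMap.sub_apply, LinearMap.id_apply]
      exact hf_typ i j _ (hπtyp i j x hx).2)
    (fun d hd ↦ by
      rw [LinearMap.comp_apply, LinearMap.sub_apply, LinearMap.id_apply, hπid d hd, sub_self, map_zero])
    (fun x d hd ↦ by
      rw [LinearMap.comp_apply, LinearMap.sub_apply, LinearMap.id_apply]
      exact hfT _ (hπsub x) d hd)
  -- the global identity `f x = (f (π x) - a π x) + a x + b e x`
  have hdec : ∀ x, f x = (f (π x) - (a : ℂ) • π x) + (a : ℂ) • x + (b : ℂ) • e x := by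
    intro x
    have h1 := hab (x - π x) (hπsub x)
    rw [LinearMap.comp_apply, LinearMap.sub_apply, LinearMap.id_apply, hπT _ (hπsub x), sub_zero,
      map_sub e, he_N _ (hπN x), sub_zero] at h1
    have h2 : f x = f (π x) + f (x - π x) := by rw [map_sub]; abel
    rw [h2, h1, smul_sub]
    abel
  -- the correction `G = f ∘ π - a π` is a sum of products of divisors
  obtain ⟨m, av, bw, haN, hbN, hG⟩ := exists_rankOne_of_range_le η hp0 hcup
    (f ∘ₗ π - (a : ℂ) • π) (fun x ↦ N.sub_mem (hfN _ (hπN x)) (N.smul_mem _ (hπN x)))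
    (fun t ht ↦ by
      rw [LinearMap.sub_apply, LinearMap.comp_apply, LinearMap.smul_apply, hπT t ht, map_zero, smul_zero,
        sub_zero])
  -- the diagonal and the class of `e`, in normal form
  obtain ⟨δ, hδalg, hδact⟩ := exists_diagonal_correspondence μ hS
  obtain ⟨γ, hγalg, hγact⟩ := hγ
  obtain ⟨uδ, s₄, s₀, hδn⟩ := kunneth_four μ hS hKS hp0 ((Pi.basisFun ℂ K3Index).map η.symm) δ
  obtain ⟨uγ, r₄, r₀, hγn⟩ := kunneth_four μ hS hKS hp0 ((Pi.basisFun ℂ K3Index).map η.symm) γ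
  simp only [hbVb] at hδn hγn
  have hδact' : ∀ x, ∑ k, k3Form (η x) (η (uδ k)) • η.symm (Pi.single k 1) = c₀⁻¹ • x := fun x ↦ by
    have h := hδact x
    rw [hδn, corr_normalForm hS hcup μ hFI] at h
    have h' := congrArg (fun y ↦ c₀⁻¹ • y) h
    simpa only [smul_smul, inv_mul_cancel₀ hc₀, one_smul] using h'
  have hγact' : ∀ x, ∑ k, k3Form (η x) (η (uγ k)) • η.symm (Pi.single k 1) = c₀⁻¹ • e x := fun x ↦ by
    have h := hγact x
    rw [hγn, corr_normalForm hS hcup μ hFI] at h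
    rw [h, smul_smul, inv_mul_cancel₀ hc₀, one_smul]
  -- the corrected datum `w` acts by zero, hence vanishes
  obtain ⟨κ, hκ⟩ : ∃ κ : K3Index → complexBetti S (2 * 1), ∀ k, κ k = ∑ i, η (bw i) k • av i :=
    ⟨_, fun k ↦ rfl⟩
  have hκ' : κ = fun k ↦ ∑ i, η (bw i) k • av i := funext hκ
  have hwact : ∀ x, ∑ k, k3Form (η x) (η ((u - κ - ((a : ℂ) * c₀) • uδ - ((b : ℂ) * c₀) • uγ) k)) •
      η.symm (Pi.single k 1) = 0 := by
    intro x
    have hac : (a : ℂ) * c₀ * c₀⁻¹ = a := by field_simp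
    have hbc : (b : ℂ) * c₀ * c₀⁻¹ = b := by field_simp
    rw [act_sub, act_sub, act_sub, act_smul, act_smul, ← hf x, hκ', act_sum_cross, hδact', hγact', ← hG x,
      LinearMap.sub_apply, LinearMap.comp_apply, LinearMap.smul_apply, hdec x, smul_smul, smul_smul, hac, hbc]
    abel
  have hw0 := eq_zero_of_act_eq_zero η _ hwact
  have hu : u = κ + ((a : ℂ) * c₀) • uδ + ((b : ℂ) * c₀) • uγ := by
    rw [← sub_eq_zero, ← hw0]; abel
  -- hence the middle component of `c` is a combination of algebraic classes
  have hmid : (∑ k, cupProduct (rfl : 2 * 1 + 2 * 1 = 2 * 2)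
      (complexBetti.map (fst S S) (2 * 1) (η.symm (Pi.single k 1)))
      (complexBetti.map (snd S S) (2 * 1) (u k))) =
      (∑ i, cupProduct (rfl : 2 * 1 + 2 * 1 = 2 * 2) (complexBetti.map (fst S S) (2 * 1) (bw i))
        (complexBetti.map (snd S S) (2 * 1) (av i))) +
      ((a : ℂ) * c₀) • (δ - s₄ • complexBetti.map (snd S S) (2 * 2) p - s₀ • complexBetti.map (fst S S) (2 * 2) p) +
      ((b : ℂ) * c₀) • (γ - r₄ • complexBetti.map (snd S S) (2 * 2) p - r₀ • complexBetti.map (fst S S) (2 * 2) p) := by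
    have hδm : δ - s₄ • complexBetti.map (snd S S) (2 * 2) p - s₀ • complexBetti.map (fst S S) (2 * 2) p =
        ∑ k, cupProduct (rfl : 2 * 1 + 2 * 1 = 2 * 2)
          (complexBetti.map (fst S S) (2 * 1) (η.symm (Pi.single k 1)))
          (complexBetti.map (snd S S) (2 * 1) (uδ k)) := by rw [hδn]; abel
    have hγm : γ - r₄ • complexBetti.map (snd S S) (2 * 2) p - r₀ • complexBetti.map (fst S S) (2 * 2) p =
        ∑ k, cupProduct (rfl : 2 * 1 + 2 * 1 = 2 * 2)
          (complexBetti.map (fst S S) (2 * 1) (η.symm (Pi.single k 1)))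
          (complexBetti.map (snd S S) (2 * 1) (uγ k)) := by rw [hγn]; abel
    rw [hu, mid_add, mid_add, mid_smul, mid_smul, hδm, hγm, sum_cross_eq_mid η av bw, hκ']
  -- conclude
  have halgN : (∑ i, cupProduct (rfl : 2 * 1 + 2 * 1 = 2 * 2) (complexBetti.map (fst S S) (2 * 1) (bw i))
      (complexBetti.map (snd S S) (2 * 1) (av i))) ∈ algebraicClasses (S ⊗ S) 2 :=
    Submodule.sum_mem _ fun i _ ↦
      cupProduct_fst_snd_mem_algebraicClasses_of_eq hS hS (hbN i) (haN i) (rfl : 1 + 1 = 2) _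
  have hsndp : complexBetti.map (snd S S) (2 * 2) p ∈ algebraicClasses (S ⊗ S) 2 := by
    have h := cupProduct_map_fst_map_snd_mem_algebraicClasses hS hS (l := 0) (k := 2)
      (a := singularCohomology.one ℂ (ComplexPoints S)) (b := p)
      (by rw [algebraicClasses_zero]; exact Submodule.mem_top)
      (mem_algebraicClasses_of_degree_top hS (by norm_num) p)
    rwa [singularCohomology.map_one, one_cupProduct] at h
  have hfstp : complexBetti.map (fst S S) (2 * 2) p ∈ algebraicClasses (S ⊗ S) 2 := by
    have h := cupProduct_map_fst_map_snd_mem_algebraicClasses hS hS (l := 2) (k := 0) (a := p)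
      (b := singularCohomology.one ℂ (ComplexPoints S))
      (mem_algebraicClasses_of_degree_top hS (by norm_num) p)
      (by rw [algebraicClasses_zero]; exact Submodule.mem_top)
    rwa [singularCohomology.map_one, cupProduct_one] at h
  rw [hcn, hmid]
  refine Submodule.add_mem _ (Submodule.add_mem _ (Submodule.add_mem _ (Submodule.add_mem _ halgN
    (Submodule.smul_mem _ _ (Submodule.sub_mem _ (Submodule.sub_mem _ hδalg (Submodule.smul_mem _ _ hsndp))
      (Submodule.smul_mem _ _ hfstp))))
    (Submodule.smul_mem _ _ (Submodule.sub_mem _ (Submodule.sub_mem _ hγalg (Submodule.smul_mem _ _ hsndp))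
      (Submodule.smul_mem _ _ hfstp))))
    (Submodule.smul_mem _ _ hsndp)) (Submodule.smul_mem _ _ hfstp)
end Summit.HodgeConjecture.HodgeConjecture.Theorems.NikulinTwinTransport

end
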